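/-
Copyright (c) 2026 the pub-hodgecm-mathlib formalisation cell (harness21).  Prover seat hodgecm-mathlib-F0P3a-p09 (g8): line LH3 (closer stub `stub_N9`), LETTER L1 clause (I₁),
organ O-L1d′ mixed scalar corners — sliver (α) «COFACTOR DRESS AT A MIXED CORNER, m-FOLD» (LH3-plan (g4) DEFAULT DEAL 2026-09-02T12:20:19Z; binder of record F0P3a-p08 (g23)).
-/
import Literature.NumberTheory.Rogawski1990.ArchOrbFamGFaceWeylFactor           -- ★ p851421 (F0P3a-p08 (g23)) (D-face): `exists_contDiff_cptFactor_eq_mul_two_sin`; brings ★ p851280 (s1) `exists_contDiff_cptFactor_eq_mul_rootProduct_sub`, ★ `rootProduct`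
import Literature.NumberTheory.Rogawski1990.ArchOrbFamGExtWallFactorSmooth      -- ★ (LH1-p03 (g5)): `contDiff_coe_circleExp_comp_of_contDiff`
import HarnessLib

/-!
# The cofactor dress at a MIXED corner, m-fold: the compact part of Shelstad's normaliser is «entire × ∏_faces 2 sin ψ_j × ∏_scalar places π(θ_k)»
# (Shelstad 1979 §4 Lemma 4.3; Rogawski 1990 §8.2; Warner II §8.4.1; Bouaziz 1994 §3.1)

Topic `NumberTheory/Rogawski1990`; namespace `Literature.NumberTheory.Rogawski1990`.  THEOREMS ONLY (no `def`, no instance, no notation, no axiom, no named fact, no `sorry`).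
Cell `pub/hodgecm-mathlib`, crux H413 (`stmt-HodgeConjecture-24833`), F0∕P3c line LH3 (closer stub `stub_N9`, DIRECT ROAD `F0_P3c_StubN9Direct`, leaf v8∕v9), LETTER L1 clause (I₁),
organ **O-L1d′ `stub_N9hcCentralMixedJetBounds`** (the `hCm` callback of ★ (I₁-asm) `smoothBounded_orbFamGExt_of_strata₄`): sliver **(α) «COFACTOR DRESS, m-FOLD»** for the binder of
record F0P3a-p08 (g23)'s assembly chain «PKG-T → ★ `PiIntegralSumReindex` + Fubini → (M2)×m₁ → tower identification → DRESS → ★ `…_of_mixedModel` (p851386) → ★ normalisation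
(p851409)».  Count-neutral.

THE MATHEMATICS (algebra + calculus, GLOBAL — no neighbourhood, no orbital integral).  The compact part of the normaliser `R′_{S′}` (★ `archRG`; the first factor of PKG-T ∕ ★ (M1)
`orbFamG_eq_unfoldedModel_pi_isolate_of_regG`) is the product over the compact-chart places `w ∉ S′` of `T_w(c) = (1 − e^{i(c_{w1}−c_{w0})})(1 − e^{i(c_{w2}−c_{w0})})(1 − e^{i(c_{w2}−c_{w1})})`.
Enumerate the `(0,2)`-FACES `e₁ : Fin m₁ → W` and the SCALAR places `e₂ : Fin m₂ → W` (injective, disjoint ranges, all off `S′`; the base point `x` literally scalar at every `e₂ k`).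
Then for EVERY `c`
  `∏_{w ∉ S′} T_w(c) = v(c) · ↑(∏_j 2 sin((c_{(e₁ j)0} − c_{(e₁ j)2})∕2)) · ↑(∏_k rootProduct(l ↦ c_{(e₂ k) τ_k⁻¹ l} − x_{(e₂ k) τ_k⁻¹ l}))`
with ONE real-smooth `v` on the whole coordinate space — the single-place halves are ★ (D-face) `exists_contDiff_cptFactor_eq_mul_two_sin` (F0P3a-p08 (g23)) and ★ (s1)
`exists_contDiff_cptFactor_eq_mul_rootProduct_sub` (any relabelling `τ_k ∈ S₃`); every other compact-chart factor is entire; the product is split at `image e₁ ∪ image e₂ ⊆ {w ∉ S′}`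
(Mathlib `Finset.prod_sdiff`, `Finset.prod_union`, `Finset.prod_image`, `Finset.prod_mul_distrib`).  These are EXACTLY the two real prefactors `∏ k : Fin m₁, 2 * Real.sin (Φ₁ c k)` and
`∏ k : Fin m₂, rootProduct ((Φ₂ c − Φ₂ x) k)` of the `hfac` socket of ★ `exists_nhds_bddAbove_norm_iteratedFDeriv_orbFamGExt_of_mixedModel` once the consumer's charts read
`Φ₁ c j = (c_{(e₁ j)0} − c_{(e₁ j)2})∕2` and `Φ₂ c k l = c_{(e₂ k) τ_k⁻¹ l}` (`Complex.real_smul` turns `•` into `↑(∏ …) *`).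
HONEST LABEL: bookkeeping only; HC_CM is proved only modulo the 7 printed citations (2 remaining: hLiu418 = `stmt-HodgeConjecture-24832`, h413 = `stmt-HodgeConjecture-24833`)
until rung 0 closes; this file moves no row of the books.

## References
* [Shelstad1979] D. Shelstad, *Characters and inner forms of a quasi-split group over ℝ*, Compositio Math. 39 (1979), §4 p. 22 (`R_T`), Lemma 4.3 (p. 25).
* [Rogawski1990] J. D. Rogawski, *Automorphic Representations of Unitary Groups in Three Variables*, Ann. of Math. Stud. 123 (1990), §8.2 pp. 118–124.
* [WarnerHASSLG2] G. Warner, *Harmonic Analysis on Semi-Simple Lie Groups II*, Grundlehren 189 (1972), §8.4.1 (`π = ∏ α`), Thm. 8.4.3.1.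
* [Bouaziz1994IntegralesOrbitales] A. Bouaziz, *Intégrales orbitales sur les groupes de Lie réductifs*, Ann. Sci. ÉNS 27 (1994), §3.1 (I₁) p. 579.
-/

set_option autoImplicit false

noncomputable section

open Function Complex
open Literature.Geometry.ComplexHyperbolic.BallModel
open scoped ContDiff

namespace Literature.NumberTheory.Rogawski1990

variable {W : Type*} [Fintype W] [DecidableEq W]

omit [DecidableEq W] in
/-- Every compact factor `c ↦ (1 − e^{i(c_{w1}−c_{w0})})(1 − e^{i(c_{w2}−c_{w0})})(1 − e^{i(c_{w2}−c_{w1})})` of the normaliser is real-smooth on the whole coordinate space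
(★ `contDiff_coe_circleExp_comp_of_contDiff`). [cite: Rogawski1990, §8.2 p. 122] [cite: Shelstad1979, §4 p. 22] -/
theorem contDiff_cptFactor (w : W) :
    ContDiff ℝ ∞ fun c : W → Fin 3 → ℝ =>
      (1 - (Circle.exp (c w 1 - c w 0) : ℂ)) * (1 - (Circle.exp (c w 2 - c w 0) : ℂ)) * (1 - (Circle.exp (c w 2 - c w 1) : ℂ)) := by
  have he : ∀ i j : Fin 3, ContDiff ℝ ∞ fun c : W → Fin 3 → ℝ => (Circle.exp (c w j - c w i) : ℂ) := fun i j =>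
    contDiff_coe_circleExp_comp_of_contDiff ((contDiff_apply_apply ℝ ℝ w j).sub (contDiff_apply_apply ℝ ℝ w i))
  exact ((contDiff_const.sub (he 0 1)).mul (contDiff_const.sub (he 0 2))).mul (contDiff_const.sub (he 1 2))

/-- **THE COFACTOR DRESS AT A MIXED CORNER, m-FOLD (GLOBAL).**  Data: a chart label `S′`, a base point `x`, the `(0,2)`-FACES `e₁ : Fin m₁ → W` and the SCALAR places
`e₂ : Fin m₂ → W` (both injective, with disjoint ranges, all off `S′`), relabellings `τ_k ∈ S₃` of the scalar places, and `x` literally scalar at every `e₂ k` (`hx`).  THEN there is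
ONE real-smooth `v` on the whole coordinate space with, for EVERY `c`,
`∏_{w ∉ S′} (1 − e^{i(c_{w1}−c_{w0})})(1 − e^{i(c_{w2}−c_{w0})})(1 − e^{i(c_{w2}−c_{w1})}) = v(c) · ↑(∏_j 2 sin((c_{(e₁ j)0} − c_{(e₁ j)2})∕2)) · ↑(∏_k rootProduct(l ↦ c_{(e₂ k) τ_k⁻¹ l} − x_{(e₂ k) τ_k⁻¹ l}))`
— the two real prefactors of the MIXED TOWER (face stage `∏ 2 sin ψ_k`, central stage `∏ π(θ_k)`) of ★ `exists_nhds_bddAbove_norm_iteratedFDeriv_orbFamGExt_of_mixedModel`, read at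
`ψ_j = (c_{(e₁ j)0} − c_{(e₁ j)2})∕2` and `θ_k = (c − x)_{e₂ k} ∘ τ_k⁻¹`.  Proof: ★ (D-face) at each face and ★ (s1) at each scalar place (both by `choose`), the product split at
`image e₁ ∪ image e₂ ⊆ {w ∉ S′}` (Mathlib `Finset.prod_sdiff`, `Finset.prod_union`, `Finset.prod_image`, `Finset.prod_mul_distrib`); `v` = (the other compact factors) · (∏ face units) ·
(∏ (s1)-units). [cite: Shelstad1979, §4 p. 22; Lemma 4.3 (p. 25)] [cite: Rogawski1990, §8.2 pp. 118–124] [cite: WarnerHASSLG2, §8.4.1] [cite: Bouaziz1994IntegralesOrbitales, §3.1 (I₁) p. 579] -/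
theorem exists_contDiff_cptTrig_eq_mul_prod_sin_mul_prod_rootProduct (S' : Finset W) (x : W → Fin 3 → ℝ)
    {m₁ m₂ : ℕ} (e₁ : Fin m₁ → W) (e₂ : Fin m₂ → W) (he₁ : Injective e₁) (he₂ : Injective e₂)
    (hdisj : ∀ (j : Fin m₁) (k : Fin m₂), e₁ j ≠ e₂ k) (he₁S : ∀ j, e₁ j ∉ S') (he₂S : ∀ k, e₂ k ∉ S')
    (τ : Fin m₂ → Equiv.Perm (Fin 3)) (hx : ∀ (k : Fin m₂) (l l' : Fin 3), x (e₂ k) l = x (e₂ k) l') :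
    ∃ v : (W → Fin 3 → ℝ) → ℂ, ContDiff ℝ ∞ v ∧ ∀ c : W → Fin 3 → ℝ,
      (∏ w ∈ Finset.univ.filter (fun w : W => w ∉ S'),
          ((1 - (Circle.exp (c w 1 - c w 0) : ℂ)) * (1 - (Circle.exp (c w 2 - c w 0) : ℂ)) * (1 - (Circle.exp (c w 2 - c w 1) : ℂ)))) =
        v c * ((∏ j : Fin m₁, 2 * Real.sin ((c (e₁ j) 0 - c (e₁ j) 2) / 2) : ℝ) : ℂ) *
          ((∏ k : Fin m₂, rootProduct (fun l => c (e₂ k) ((τ k).symm l) - x (e₂ k) ((τ k).symm l)) : ℝ) : ℂ) := by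
  -- ★ (D-face) at every face, ★ (s1) at every scalar place
  choose vf hvf hvffac using fun j : Fin m₁ => exists_contDiff_cptFactor_eq_mul_two_sin (e₁ j)
  choose vs hvs hvsfac using fun k : Fin m₂ => exists_contDiff_cptFactor_eq_mul_rootProduct_sub (e₂ k) (τ k) x (hx k)
  -- the face ∕ scalar finsets inside the compact-chart places
  set T : Finset W := Finset.univ.filter (fun w : W => w ∉ S') with hT
  set F₁ : Finset W := Finset.univ.image e₁ with hF₁
  set F₂ : Finset W := Finset.univ.image e₂ with hF₂
  have hsub : F₁ ∪ F₂ ⊆ T := by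
    intro w hw
    rcases Finset.mem_union.1 hw with h | h
    · obtain ⟨j, -, rfl⟩ := Finset.mem_image.1 h
      exact Finset.mem_filter.2 ⟨Finset.mem_univ _, he₁S j⟩
    · obtain ⟨k, -, rfl⟩ := Finset.mem_image.1 h
      exact Finset.mem_filter.2 ⟨Finset.mem_univ _, he₂S k⟩
  have hdj : Disjoint F₁ F₂ := by
    refine Finset.disjoint_left.2 fun w h₁ h₂ => ?_
    obtain ⟨j, -, rfl⟩ := Finset.mem_image.1 h₁
    obtain ⟨k, -, hk⟩ := Finset.mem_image.1 h₂
    exact hdisj j k hk.symm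
  refine ⟨fun c => (∏ w ∈ T \ (F₁ ∪ F₂), ((1 - (Circle.exp (c w 1 - c w 0) : ℂ)) * (1 - (Circle.exp (c w 2 - c w 0) : ℂ)) * (1 - (Circle.exp (c w 2 - c w 1) : ℂ)))) *
      (∏ j : Fin m₁, vf j c) * ∏ k : Fin m₂, vs k c, ?_, fun c => ?_⟩
  · exact ((contDiff_prod fun w _ => contDiff_cptFactor w).mul (contDiff_prod fun j _ => hvf j)).mul (contDiff_prod fun k _ => hvs k)
  · -- split the product: the rest × faces × scalar places
    have hfaces : (∏ w ∈ F₁, ((1 - (Circle.exp (c w 1 - c w 0) : ℂ)) * (1 - (Circle.exp (c w 2 - c w 0) : ℂ)) * (1 - (Circle.exp (c w 2 - c w 1) : ℂ)))) =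
        (∏ j : Fin m₁, vf j c) * ((∏ j : Fin m₁, 2 * Real.sin ((c (e₁ j) 0 - c (e₁ j) 2) / 2) : ℝ) : ℂ) := by
      rw [hF₁, Finset.prod_image fun j _ j' _ h => he₁ h, Complex.ofReal_prod, ← Finset.prod_mul_distrib]
      exact Finset.prod_congr rfl fun j _ => hvffac j c
    have hscalar : (∏ w ∈ F₂, ((1 - (Circle.exp (c w 1 - c w 0) : ℂ)) * (1 - (Circle.exp (c w 2 - c w 0) : ℂ)) * (1 - (Circle.exp (c w 2 - c w 1) : ℂ)))) =
        (∏ k : Fin m₂, vs k c) * ((∏ k : Fin m₂, rootProduct (fun l => c (e₂ k) ((τ k).symm l) - x (e₂ k) ((τ k).symm l)) : ℝ) : ℂ) := by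
      rw [hF₂, Finset.prod_image fun k _ k' _ h => he₂ h, Complex.ofReal_prod, ← Finset.prod_mul_distrib]
      exact Finset.prod_congr rfl fun k _ => hvsfac k c
    rw [← Finset.prod_sdiff hsub, Finset.prod_union hdj, hfaces, hscalar]
    ring

end Literature.NumberTheory.Rogawski1990

end
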